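import Summits.QuantumFields.YangMills.Theorems.LuscherReductionRunningReductionPolyakovLine
import Summits.QuantumFields.YangMills.Theorems.LuscherReductionRunningReductionActionPhase
import Summits.QuantumFields.YangMills.Theorems.LuscherReductionTwistedTraceScalingBOSupportGeometry
import HarnessLib

/-!
# Polyakov-line separation of tube fibres over distant slow data — the GEOMETRIC half of the far-pair kernel estimate (K-far) of hT at rate
# (route `FlatTubeReduction`, crux K1 `NearFlatRatioLaw` stmt-QuantumFields-24720; seat `ym-line-ftr-p1` g14; rate twin «ratepack-v3 / frozen fibres»; R2b1 RECORD rung — no summit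
# statement is proved here)

WHY (memo `Cruxes/NearFlatRatioLaw/Lines/ratepack-v3-frozen-g12.md` §8.3).  hT at rate needs, for FAR slow pairs `(u,u')`, that BOTH the BO kernel `𝒦_β(u,u')` and the one-site kernel
`K̃₁^{(L³β)}(u,u')` are Gaussian-small; RED's `transferKernel_le_crossBound` turns a lower bound on `Σ_e ‖U_e − V_e‖_F` into `K_β(U,V) ≤ e^{2β|E|}e^{−(β/2)(Σ‖U_e−V_e‖)²/|E|}`, so what is
missing is a LOWER bound on `Σ_e ‖(orthoTube u v)_e − (g·orthoTube u' v')_e‖_F` uniform in the lattice gauge transformation `g`.  The closed Polyakov lines provide it: they are products of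
`L` links (telescoping), those of a tube fibre are within `4L·max‖v_e‖` of the `L`-th powers `u_k^L` of the slow links, they are gauge-COVARIANT (`lineProd_gaugeTransform_closed`), and at
each site the three lines are conjugated by the SAME `g(x)`; averaging over the base point:
* `frobNorm_lineProd_sub_lineProd_le` — `‖P_k^U(x;n) − P_k^V(x;n)‖_F ≤ Σ_{j<n} ‖U(x+jê_k,k) − V(x+jê_k,k)‖_F`;
* `lineProd_orthoTube_zero`, `frobNorm_lineProd_orthoTube_sub_pow_le` — `‖P_k(orthoTube u v; x; n) − u_k^n‖_F ≤ 4n·r` when `‖v_e‖ ≤ r ≤ ½`;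
* `sum_site_shift_line` — `Σ_x Σ_{j<L} f(x+jê_k, k) = L·Σ_x f(x,k)` (every link lies on `L` based lines);
* ★★ `exists_site_conj_powers_le` — for every lattice gauge `g` there is a site `x` with
  `L²·Σ_k ‖u_k^L − g(x)·u'_k^L·g(x)⁻¹‖_F ≤ Σ_e ‖(orthoTube u v)_e − (orthoTube u' v')^g_e‖_F + 12L³(r + r')`.
HONEST FRAMING: lattice geometry only; the kernel half (RED's cross bound + the `L`-th power lower bound near `1` + integration against the profiles) is the next file of K-far; K-near, ST, ODpot
untouched; femto rung R2b1 (RECORD label); not infinite volume, not a gap, not Clay.  No defs, no named facts, no `sorry`.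
-/

set_option autoImplicit false

noncomputable section

open MeasureTheory Filter Topology Real
open scoped BigOperators
open Literature.MathematicalPhysics.QuantumFieldTheory
open Literature.MathematicalPhysics.QuantumLattice

namespace Summit.QuantumFields.YangMills.Theorems.FemtoTransferGap.TwoLattice.ConstTube

open Summit.QuantumFields.YangMills.Theorems.FemtoTransferGap

variable {L : ℕ} [NeZero L]

/-! ## §1 Telescoping of Polyakov lines -/

omit [NeZero L] in
/-- `‖P_k^U(x;n) − P_k^V(x;n)‖_F ≤ Σ_{j<n} ‖U(x+jê_k,k) − V(x+jê_k,k)‖_F`. [folklore] -/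
theorem frobNorm_lineProd_sub_lineProd_le (U V : GaugeConfig 3 L SU2) (x : Site 3 L) (k : Fin 3) (n : ℕ) :
    frobNorm (((lineProd U x k n : SU2) : Matrix (Fin 2) (Fin 2) ℂ) - ((lineProd V x k n : SU2) : Matrix (Fin 2) (Fin 2) ℂ)) ≤
      ∑ j ∈ Finset.range n, frobNorm (((U (x + (Pi.single k ((j : ℕ) : ZMod L) : Site 3 L), k) : SU2) : Matrix (Fin 2) (Fin 2) ℂ) -
        ((V (x + (Pi.single k ((j : ℕ) : ZMod L) : Site 3 L), k) : SU2) : Matrix (Fin 2) (Fin 2) ℂ)) := by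
  induction n with
  | zero => simp [lineProd, frobNorm_zero]
  | succ n ih =>
    rw [lineProd_succ, lineProd_succ, Finset.sum_range_succ]
    exact (frobNorm_mul_sub_mul_le _ _ _ _).trans (by linarith)

omit [NeZero L] in
/-- The Polyakov line of the fibre point over `u` through `v = 0` is the power of the slow link: `P_k(orthoTube u 0; x; n) = u_k^n`. [folklore] -/
theorem lineProd_orthoTube_zero (u : GaugeConfig 3 1 SU2) (x : Site 3 L) (k : Fin 3) (n : ℕ) : lineProd (orthoTube L u 0) x k n = u (0, k) ^ n := by
  induction n with
  | zero => simp [lineProd]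
  | succ n ih => rw [lineProd_succ, ih, orthoTube_apply, Pi.zero_apply, chartSU2_zero', one_mul, pow_succ]

omit [NeZero L] in
/-- `‖P_k(orthoTube u v; x; n) − u_k^n‖_F ≤ 4n·r` when `‖v_e‖ ≤ r ≤ ½`. [folklore] -/
theorem frobNorm_lineProd_orthoTube_sub_pow_le (u : GaugeConfig 3 1 SU2) {v : Edge 3 L → Fin 3 → ℝ} {r : ℝ} (hr : r ≤ 1 / 2) (hv : ∀ e, ‖v e‖ ≤ r)
    (x : Site 3 L) (k : Fin 3) (n : ℕ) :
    frobNorm (((lineProd (orthoTube L u v) x k n : SU2) : Matrix (Fin 2) (Fin 2) ℂ) - ((u (0, k) ^ n : SU2) : Matrix (Fin 2) (Fin 2) ℂ)) ≤ 4 * n * r := by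
  rw [← lineProd_orthoTube_zero u x k n]
  refine (frobNorm_lineProd_sub_lineProd_le _ _ x k n).trans ?_
  have hlink : ∀ e : Edge 3 L, frobNorm (((orthoTube L u v e : SU2) : Matrix (Fin 2) (Fin 2) ℂ) - ((orthoTube L u 0 e : SU2) : Matrix (Fin 2) (Fin 2) ℂ)) ≤ 4 * r := by
    intro e
    rw [orthoTube_apply, orthoTube_apply, Pi.zero_apply, chartSU2_zero', one_mul, Submonoid.coe_mul,
      show ((chartSU2 (v e) : SU2) : Matrix (Fin 2) (Fin 2) ℂ) * ((u (0, e.2) : SU2) : Matrix (Fin 2) (Fin 2) ℂ) - ((u (0, e.2) : SU2) : Matrix (Fin 2) (Fin 2) ℂ) =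
        (((chartSU2 (v e) : SU2) : Matrix (Fin 2) (Fin 2) ℂ) - 1) * ((u (0, e.2) : SU2) : Matrix (Fin 2) (Fin 2) ℂ) by rw [Matrix.sub_mul, Matrix.one_mul],
      frobNorm_mul_unitary _ (su2_mem_unitaryGroup _)]
    exact (frobNorm_chartSU2_sub_one_le ((hv e).trans hr)).trans (by linarith [hv e])
  calc ∑ j ∈ Finset.range n, frobNorm (((orthoTube L u v (x + (Pi.single k ((j : ℕ) : ZMod L) : Site 3 L), k) : SU2) : Matrix (Fin 2) (Fin 2) ℂ) -
          ((orthoTube L u 0 (x + (Pi.single k ((j : ℕ) : ZMod L) : Site 3 L), k) : SU2) : Matrix (Fin 2) (Fin 2) ℂ))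
      ≤ ∑ _j ∈ Finset.range n, 4 * r := Finset.sum_le_sum fun j _ => hlink _
    _ = 4 * n * r := by rw [Finset.sum_const, Finset.card_range, nsmul_eq_mul]; ring

/-! ## §2 Every link lies on `L` based lines -/

/-- `Σ_x Σ_{j<L} f(x + jê_k) = L · Σ_x f(x)` on the torus (translation invariance of `Σ_x`). [folklore] -/
theorem sum_site_shift_line (f : Site 3 L → ℝ) (k : Fin 3) :
    ∑ x : Site 3 L, ∑ j ∈ Finset.range L, f (x + (Pi.single k ((j : ℕ) : ZMod L) : Site 3 L)) = L * ∑ x : Site 3 L, f x := by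
  rw [Finset.sum_comm]
  have h : ∀ j ∈ Finset.range L, ∑ x : Site 3 L, f (x + (Pi.single k ((j : ℕ) : ZMod L) : Site 3 L)) = ∑ x : Site 3 L, f x := fun j _ =>
    Fintype.sum_equiv (Equiv.addRight (Pi.single k ((j : ℕ) : ZMod L) : Site 3 L)) _ _ fun x => rfl
  rw [Finset.sum_congr rfl h, Finset.sum_const, Finset.card_range, nsmul_eq_mul]

/-! ## §3 ★★ Separation -/

omit [NeZero L] in
/-- Conjugation does not change Frobenius distances: `‖gAg⁻¹ − gBg⁻¹‖_F = ‖A − B‖_F`. [folklore] -/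
theorem frobNorm_conj_sub_conj (g A B : SU2) :
    frobNorm (((g * A * g⁻¹ : SU2) : Matrix (Fin 2) (Fin 2) ℂ) - ((g * B * g⁻¹ : SU2) : Matrix (Fin 2) (Fin 2) ℂ)) =
      frobNorm ((A : Matrix (Fin 2) (Fin 2) ℂ) - (B : Matrix (Fin 2) (Fin 2) ℂ)) := by
  have e : ((g * A * g⁻¹ : SU2) : Matrix (Fin 2) (Fin 2) ℂ) - ((g * B * g⁻¹ : SU2) : Matrix (Fin 2) (Fin 2) ℂ) =
      (g : Matrix (Fin 2) (Fin 2) ℂ) * ((A : Matrix (Fin 2) (Fin 2) ℂ) - (B : Matrix (Fin 2) (Fin 2) ℂ)) * ((g⁻¹ : SU2) : Matrix (Fin 2) (Fin 2) ℂ) := by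
    simp only [Submonoid.coe_mul, Matrix.mul_sub, Matrix.sub_mul]
  rw [e, frobNorm_mul_unitary _ (su2_mem_unitaryGroup _), frobNorm_unitary_mul (su2_mem_unitaryGroup _)]

/-- ★★ **POLYAKOV SEPARATION.**  `U = orthoTube u v`, `V = orthoTube u' v'` with `‖v_e‖ ≤ r ≤ ½`, `‖v'_e‖ ≤ r' ≤ ½`; for every lattice gauge transformation `g` there is a site `x` with
`L²·Σ_k ‖u_k^L − g(x)·u'_k^L·g(x)⁻¹‖_F ≤ Σ_e ‖U_e − (V^g)_e‖_F + 12·L³·(r + r')`. [cite: tHooft1979] -/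
theorem exists_site_conj_powers_le (u u' : GaugeConfig 3 1 SU2) {v v' : Edge 3 L → Fin 3 → ℝ} {r r' : ℝ} (hr : r ≤ 1 / 2) (hv : ∀ e, ‖v e‖ ≤ r)
    (hr' : r' ≤ 1 / 2) (hv' : ∀ e, ‖v' e‖ ≤ r') (g : Site 3 L → SU2) :
    ∃ x : Site 3 L, (L : ℝ) ^ 2 * ∑ k : Fin 3, frobNorm (((u (0, k) ^ L : SU2) : Matrix (Fin 2) (Fin 2) ℂ) - ((g x * u' (0, k) ^ L * (g x)⁻¹ : SU2) : Matrix (Fin 2) (Fin 2) ℂ)) ≤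
      ∑ e : Edge 3 L, frobNorm (((orthoTube L u v e : SU2) : Matrix (Fin 2) (Fin 2) ℂ) - ((gaugeTransform g (orthoTube L u' v') e : SU2) : Matrix (Fin 2) (Fin 2) ℂ)) +
        12 * (L : ℝ) ^ 3 * (r + r') := by
  set U : GaugeConfig 3 L SU2 := orthoTube L u v with hU
  set W : GaugeConfig 3 L SU2 := gaugeTransform g (orthoTube L u' v') with hW
  set D : Edge 3 L → ℝ := fun e => frobNorm (((U e : SU2) : Matrix (Fin 2) (Fin 2) ℂ) - ((W e : SU2) : Matrix (Fin 2) (Fin 2) ℂ)) with hD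
  set F : Site 3 L → ℝ := fun x => ∑ k : Fin 3, frobNorm (((u (0, k) ^ L : SU2) : Matrix (Fin 2) (Fin 2) ℂ) - ((g x * u' (0, k) ^ L * (g x)⁻¹ : SU2) : Matrix (Fin 2) (Fin 2) ℂ))
    with hF
  have hL0 : (0 : ℝ) < L := by exact_mod_cast Nat.pos_of_ne_zero (NeZero.ne L)
  have hr0 : 0 ≤ r := (norm_nonneg _).trans (hv ((fun _ => 0), 0))
  have hr0' : 0 ≤ r' := (norm_nonneg _).trans (hv' ((fun _ => 0), 0))
  -- site-wise: `F x ≤ Σ_k ‖P_k^U(x) − P_k^W(x)‖ + 12 L (r + r')`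
  have hsite : ∀ x : Site 3 L, F x ≤ ∑ k : Fin 3, frobNorm (((lineProd U x k L : SU2) : Matrix (Fin 2) (Fin 2) ℂ) - ((lineProd W x k L : SU2) : Matrix (Fin 2) (Fin 2) ℂ)) +
      12 * L * (r + r') := by
    intro x
    rw [hF]; dsimp only
    have hk : ∀ k : Fin 3, frobNorm (((u (0, k) ^ L : SU2) : Matrix (Fin 2) (Fin 2) ℂ) - ((g x * u' (0, k) ^ L * (g x)⁻¹ : SU2) : Matrix (Fin 2) (Fin 2) ℂ)) ≤
        frobNorm (((lineProd U x k L : SU2) : Matrix (Fin 2) (Fin 2) ℂ) - ((lineProd W x k L : SU2) : Matrix (Fin 2) (Fin 2) ℂ)) + 4 * L * r + 4 * L * r' := by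
      intro k
      have h1 : frobNorm (((lineProd U x k L : SU2) : Matrix (Fin 2) (Fin 2) ℂ) - ((u (0, k) ^ L : SU2) : Matrix (Fin 2) (Fin 2) ℂ)) ≤ 4 * L * r :=
        frobNorm_lineProd_orthoTube_sub_pow_le u hr hv x k L
      have h2 : frobNorm (((lineProd W x k L : SU2) : Matrix (Fin 2) (Fin 2) ℂ) - ((g x * u' (0, k) ^ L * (g x)⁻¹ : SU2) : Matrix (Fin 2) (Fin 2) ℂ)) ≤ 4 * L * r' := by
        rw [hW, lineProd_gaugeTransform_closed, frobNorm_conj_sub_conj]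
        exact frobNorm_lineProd_orthoTube_sub_pow_le u' hr' hv' x k L
      -- triangle: `‖a − d‖ ≤ ‖P − a‖ + ‖P − Q‖ + ‖Q − d‖`
      set a : Matrix (Fin 2) (Fin 2) ℂ := ((u (0, k) ^ L : SU2) : Matrix (Fin 2) (Fin 2) ℂ)
      set d : Matrix (Fin 2) (Fin 2) ℂ := ((g x * u' (0, k) ^ L * (g x)⁻¹ : SU2) : Matrix (Fin 2) (Fin 2) ℂ)
      set P : Matrix (Fin 2) (Fin 2) ℂ := ((lineProd U x k L : SU2) : Matrix (Fin 2) (Fin 2) ℂ)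
      set Q : Matrix (Fin 2) (Fin 2) ℂ := ((lineProd W x k L : SU2) : Matrix (Fin 2) (Fin 2) ℂ)
      have e : a - d = (a - P) + ((P - Q) + (Q - d)) := by abel
      rw [e]
      have t1 := frobNorm_add_le' (a - P) ((P - Q) + (Q - d))
      have t2 := frobNorm_add_le' (P - Q) (Q - d)
      rw [frobNorm_sub_comm a P] at t1
      linarith
    calc ∑ k : Fin 3, frobNorm (((u (0, k) ^ L : SU2) : Matrix (Fin 2) (Fin 2) ℂ) - ((g x * u' (0, k) ^ L * (g x)⁻¹ : SU2) : Matrix (Fin 2) (Fin 2) ℂ))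
        ≤ ∑ k : Fin 3, (frobNorm (((lineProd U x k L : SU2) : Matrix (Fin 2) (Fin 2) ℂ) - ((lineProd W x k L : SU2) : Matrix (Fin 2) (Fin 2) ℂ)) + 4 * L * r + 4 * L * r') :=
          Finset.sum_le_sum fun k _ => hk k
      _ = ∑ k : Fin 3, frobNorm (((lineProd U x k L : SU2) : Matrix (Fin 2) (Fin 2) ℂ) - ((lineProd W x k L : SU2) : Matrix (Fin 2) (Fin 2) ℂ)) + 12 * L * (r + r') := by
          rw [Finset.sum_add_distrib, Finset.sum_add_distrib, Finset.sum_const, Finset.sum_const, Finset.card_univ, Fintype.card_fin]; simp only [nsmul_eq_mul]; push_cast; ring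
  -- sum over sites: `Σ_x Σ_k ‖P^U − P^W‖ ≤ L · Σ_e D e`
  have hlines : ∑ x : Site 3 L, ∑ k : Fin 3, frobNorm (((lineProd U x k L : SU2) : Matrix (Fin 2) (Fin 2) ℂ) - ((lineProd W x k L : SU2) : Matrix (Fin 2) (Fin 2) ℂ)) ≤
      L * ∑ e : Edge 3 L, D e := by
    calc ∑ x : Site 3 L, ∑ k : Fin 3, frobNorm (((lineProd U x k L : SU2) : Matrix (Fin 2) (Fin 2) ℂ) - ((lineProd W x k L : SU2) : Matrix (Fin 2) (Fin 2) ℂ))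
        ≤ ∑ x : Site 3 L, ∑ k : Fin 3, ∑ j ∈ Finset.range L, D (x + (Pi.single k ((j : ℕ) : ZMod L) : Site 3 L), k) :=
          Finset.sum_le_sum fun x _ => Finset.sum_le_sum fun k _ => frobNorm_lineProd_sub_lineProd_le U W x k L
      _ = ∑ k : Fin 3, ∑ x : Site 3 L, ∑ j ∈ Finset.range L, D (x + (Pi.single k ((j : ℕ) : ZMod L) : Site 3 L), k) := Finset.sum_comm
      _ = ∑ k : Fin 3, (L * ∑ x : Site 3 L, D (x, k)) := Finset.sum_congr rfl fun k _ => sum_site_shift_line (fun x => D (x, k)) k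
      _ = L * ∑ e : Edge 3 L, D e := by rw [← Finset.mul_sum, Fintype.sum_prod_type, Finset.sum_comm]
  -- average over the `L³` sites
  have hcard : (Fintype.card (Site 3 L) : ℝ) = (L : ℝ) ^ 3 := by
    rw [show Fintype.card (Site 3 L) = L ^ 3 by simp [Site, Fintype.card_fin, ZMod.card, Fintype.card_pi]]; push_cast; ring
  have hsum : ∑ x : Site 3 L, F x ≤ L * ∑ e : Edge 3 L, D e + (L : ℝ) ^ 3 * (12 * L * (r + r')) := by
    calc ∑ x : Site 3 L, F x ≤ ∑ x : Site 3 L, (∑ k : Fin 3, frobNorm (((lineProd U x k L : SU2) : Matrix (Fin 2) (Fin 2) ℂ) - ((lineProd W x k L : SU2) : Matrix (Fin 2) (Fin 2) ℂ)) +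
          12 * L * (r + r')) := Finset.sum_le_sum fun x _ => hsite x
      _ = (∑ x : Site 3 L, ∑ k : Fin 3, frobNorm (((lineProd U x k L : SU2) : Matrix (Fin 2) (Fin 2) ℂ) - ((lineProd W x k L : SU2) : Matrix (Fin 2) (Fin 2) ℂ))) +
          Fintype.card (Site 3 L) * (12 * L * (r + r')) := by rw [Finset.sum_add_distrib, Finset.sum_const, Finset.card_univ, nsmul_eq_mul]
      _ ≤ L * ∑ e : Edge 3 L, D e + (L : ℝ) ^ 3 * (12 * L * (r + r')) := by rw [hcard]; linarith [hlines]
  -- a site below the average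
  obtain ⟨x, -, hx⟩ := Finset.exists_le_of_sum_le (Finset.univ_nonempty (α := Site 3 L))
    (show ∑ x : Site 3 L, F x ≤ ∑ _x : Site 3 L, (L * ∑ e : Edge 3 L, D e + (L : ℝ) ^ 3 * (12 * L * (r + r'))) / (L : ℝ) ^ 3 by
      rw [Finset.sum_const, Finset.card_univ, nsmul_eq_mul, hcard, mul_div_cancel₀ _ (by positivity)]; exact hsum)
  refine ⟨x, ?_⟩
  have hx' : (L : ℝ) ^ 3 * F x ≤ L * ∑ e : Edge 3 L, D e + (L : ℝ) ^ 3 * (12 * L * (r + r')) := by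
    rw [le_div_iff₀ (by positivity)] at hx; linarith
  have hF0 : 0 ≤ F x := by rw [hF]; exact Finset.sum_nonneg fun k _ => frobNorm_nonneg _
  -- divide by `L`
  have : (L : ℝ) * ((L : ℝ) ^ 2 * F x) ≤ (L : ℝ) * (∑ e : Edge 3 L, D e + 12 * (L : ℝ) ^ 3 * (r + r')) := by nlinarith
  exact le_of_mul_le_mul_left this hL0

end Summit.QuantumFields.YangMills.Theorems.FemtoTransferGap.TwoLattice.ConstTube

end
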